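import Summits.BirchSwinnertonDyer.BirchSwinnertonDyer.Theorems.ResidualThetaTransportAtTwoThetaLayerLambdaCongruenceAtTwoCuspSpanGeneration
import Literature.NumberTheory.EllipticCurves.ModularCurveGenusTwoProofs
import HarnessLib

/-!
# Route `ResidualThetaTransportAtTwo`, crux Kμ⁺ `SignedMuVanishingAtTwoPlus` (stmt-BirchSwinnertonDyer-20689), line
# `birth`, stub `stub_flatMuZeroAtTwo`: **LEVEL LOWERING for the node — (G″)_M ⟹ (G″)_N for every `N ∣ M`**
# (the set of levels at which the curve-free spanning statement holds is closed under divisors)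

Cell `bsd-wall`, width seat `bsd-wall-rtt-p4-w2` (g5). THEOREMS ONLY (no `def`, no named fact, no `sorry`); helper
`--supports` the crux; closes nothing. BSD is not proved by this; every spanning statement is a HYPOTHESIS, spelled inline
(the TRACE form (G″)_N of `…CuspSpanGroup` / `…CuspSpanGamma1`: every additive `χ : Γ₀(N) → ZMod 2` killing the elements of
trace `0, ±1, ±2` and the elements with lower-right entry `±4^k`, `k ≥ 1`, is `ψ ∘ d` with `ψ` multiplicative on units).

THEOREM (`cuspSpanTrace_of_mul_prime`, `cuspSpanTrace_of_dvd`). If the trace form holds at level `M` then it holds at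
every level `N ∣ M`. Consequently (`cuspSpanEvenAtTwo_of_cuspSpanTrace_of_dvd`) the named node `CuspSpanEvenAtTwo N` and FLAT
at level `N` follow from the trace form at ANY multiple of `N`; equivalently a level at which (G″) FAILS poisons all its
multiples, so a counterexample to the class-wide research residue «(G″)_N for every odd `N`» can be sought among levels
that are minimal for divisibility, and every per-level certificate (kernel or kit) at a level `M` certifies all `N ∣ M`.

PROOF (group theory only; one prime `q` at a time, `M = N q`, `q ∣ N` allowed). Let `χ` be a character of `Γ₀(N)` as
above; its restriction to `Γ₀(Nq) ≤ Γ₀(N)` is such a character at level `Nq`, hence `= ψ_M ∘ d` there. (1) For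
`γ = (a b; c d) ∈ Γ₀(N)` with `q ∤ d` there is `j` with `Nq ∣ c − dNj`, so `γ · (1 0; −Nj 1) ∈ Γ₀(Nq)` has the SAME
lower-right entry `d`, and `χ(γ) = χ(γ L) = ψ_M(d mod Nq)` (`L` is parabolic); if `q ∣ d` replace `γ` by `γ T`
(`d ↦ c + d ≡ d (mod N)`, `q ∤ c + d`, `χ(γT) = χ(γ)`). (2) `ψ_M` kills every unit `≡ 1 (mod N)`: such a unit is
`1 + tN` with `q ∤ 1 + tN`, the lower-right entry of the PARABOLIC `(1 − tN, t²N; −N, 1 + tN) ∈ Γ₀(N)`, killed by `χ`, so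
(1) gives `ψ_M(1 + tN) = 0`. (3) Hence `ψ_M(u)` depends only on `u mod N` for units `u`, which defines `ψ_N` on the units of
`ZMod N` (every unit mod `N` lifts to a unit mod `Nq`), multiplicative, with `χ = ψ_N ∘ (d mod N)` by (1).
The induction over the prime factors of `M/N` is `nat_dvd_induction` (a statement about `ℕ` only).

Scope (numbers, not adjectives): this adds NO new level to the set where the node is a theorem (lead rtt-p3 g9: the prime
powers `p^e` with `(ℤ/p^e)ˣ = ±⟨4⟩`, `cuspSpanTrace_of_units_four_pow`; their divisors are again such prime powers); it is a
structural constraint on the open part (levels with two odd prime factors, all 147 habitat⁺ conductors). Level RAISING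
(`N ⟹ Nq`) is NOT claimed and is false as a schema ((G″)_1 holds trivially).

References: G. Shimura, *Introduction to the arithmetic theory of automorphic functions* (1971) §1.6, Prop. 1.43 (coset
representatives of `Γ₀(Nq)` in `Γ₀(N)`) [ShimuraIATAF1971]; A. W. Knapp, *Elliptic curves* (1992) Prop. 11.22 [Knapp1993];
R. Pollack, Duke Math. J. 118 (2003) Conj. 6.3 [Pollack2003].
-/

set_option autoImplicit false
set_option linter.dupNamespace false

open scoped MatrixGroups

open CongruenceSubgroup

namespace Summit.BirchSwinnertonDyer.BirchSwinnertonDyer.Theorems.SignedMuAtTwo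

/-! ## §1. Tools -/

section Tools

variable {N : ℕ}

/-- For `γ = (a b; c d) ∈ SL(2, ℤ)` and a prime `q`: `q` does not divide both `c` and `d` (`ad − bc = 1`). [folklore] -/
theorem not_dvd_apply_one_zero_of_dvd_apply_one_one {q : ℕ} (hq : q.Prime) (γ : SL(2, ℤ))
    (hd : (q : ℤ) ∣ γ 1 1) : ¬ (q : ℤ) ∣ γ 1 0 := by
  intro hc
  have hdet := Matrix.det_fin_two γ.1
  rw [γ.2] at hdet
  have h1 : (q : ℤ) ∣ 1 := by
    rw [hdet]
    exact dvd_sub (hd.mul_left _) (hc.mul_left _)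
  have := Int.eq_one_of_dvd_one (by positivity) h1
  have hq1 := hq.one_lt
  omega

/-- **Induction over the prime factors of the quotient** (a statement about `ℕ` only): a property of levels that
descends from `N q` to `N` for every prime `q` descends from `N k` to `N` for every `k ≥ 1`. [folklore] -/
theorem nat_dvd_induction {P : ℕ → Prop} (step : ∀ N q : ℕ, N ≠ 0 → q.Prime → P (N * q) → P N) :
    ∀ (k N : ℕ), N ≠ 0 → k ≠ 0 → P (N * k) → P N := by
  intro k
  induction k using Nat.strong_induction_on with
  | _ k ih =>
    intro N hN hk hP
    by_cases hk1 : k = 1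
    · subst hk1
      simpa using hP
    · obtain ⟨q, hq, k', rfl⟩ := Nat.exists_prime_and_dvd hk1
      have hk' : k' ≠ 0 := by rintro rfl; simp at hk
      have hlt : k' < q * k' := by
        have := hq.two_le
        exact (Nat.lt_mul_iff_one_lt_left (Nat.pos_of_ne_zero hk')).mpr (by omega)
      refine ih k' hlt N hN hk' (step (N * k') q (mul_ne_zero hN hk') hq ?_)
      have e : N * (q * k') = N * k' * q := by ring
      rw [e] at hP
      exact hP

end Tools

/-! ## §2. One prime: (G″)_{Nq} ⟹ (G″)_N -/

section OnePrime

variable {N q : ℕ}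

/-- **Level lowering of the trace form by one prime.** For `N ≥ 1` and a prime `q` (dividing `N` or not): if every
additive `χ : Γ₀(Nq) → ZMod 2` killing the elements of trace `0, ±1, ±2` and the elements with lower-right entry `±4^k`
(`k ≥ 1`) is `ψ ∘ d` with `ψ` multiplicative on units, then the same holds at level `N`. See the module docstring for the
proof (restriction to `Γ₀(Nq)`, parabolic coset representatives `(1 0; Nj 1)`, and the parabolics `(1 − tN, t²N; −N, 1 + tN)`
showing that `ψ_{Nq}` factors through the units mod `N`). [cite: ShimuraIATAF1971, Prop. 1.43] [cite: Knapp1993, Prop. 11.22] -/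
theorem cuspSpanTrace_of_mul_prime [NeZero N] (hq : q.Prime)
    (hG : ∀ χ : Gamma0 (N * q) → ZMod 2,
      (∀ γ δ : Gamma0 (N * q), χ (γ * δ) = χ γ + χ δ) →
      (∀ γ : Gamma0 (N * q), ((γ : SL(2, ℤ)) 0 0 + (γ : SL(2, ℤ)) 1 1).natAbs ≤ 2 → χ γ = 0) →
      (∀ γ : Gamma0 (N * q), (∃ k : ℕ, 1 ≤ k ∧ ((γ : SL(2, ℤ)) 1 1).natAbs = 4 ^ k) → χ γ = 0) →
      ∃ ψ : ZMod (N * q) → ZMod 2, (∀ x y : ZMod (N * q), IsUnit x → IsUnit y → ψ (x * y) = ψ x + ψ y) ∧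
        ∀ γ : Gamma0 (N * q), χ γ = ψ ((((γ : SL(2, ℤ)) 1 1 : ℤ) : ZMod (N * q)))) :
    ∀ χ : Gamma0 N → ZMod 2,
      (∀ γ δ : Gamma0 N, χ (γ * δ) = χ γ + χ δ) →
      (∀ γ : Gamma0 N, ((γ : SL(2, ℤ)) 0 0 + (γ : SL(2, ℤ)) 1 1).natAbs ≤ 2 → χ γ = 0) →
      (∀ γ : Gamma0 N, (∃ k : ℕ, 1 ≤ k ∧ ((γ : SL(2, ℤ)) 1 1).natAbs = 4 ^ k) → χ γ = 0) →
      ∃ ψ : ZMod N → ZMod 2, (∀ x y : ZMod N, IsUnit x → IsUnit y → ψ (x * y) = ψ x + ψ y) ∧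
        ∀ γ : Gamma0 N, χ γ = ψ ((((γ : SL(2, ℤ)) 1 1 : ℤ) : ZMod N)) := by
  classical
  intro χ hadd hsmall hkill
  haveI : NeZero (N * q) := ⟨mul_ne_zero (NeZero.ne N) hq.ne_zero⟩
  have hq2 := hq.two_le
  have hle : Gamma0 (N * q) ≤ Gamma0 N := Literature.NumberTheory.EllipticCurves.ModularForms.gamma0_le_gamma0_of_dvd (dvd_mul_right N q)
  -- restriction of `χ` to `Γ₀(Nq)`
  set χ' : Gamma0 (N * q) → ZMod 2 := fun γ ↦ χ ⟨γ.1, hle γ.2⟩ with hχ'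
  obtain ⟨ψM, hψM, hχψM⟩ := hG χ' (fun γ δ ↦ hadd ⟨γ.1, hle γ.2⟩ ⟨δ.1, hle δ.2⟩)
    (fun γ hγ ↦ hsmall ⟨γ.1, hle γ.2⟩ hγ) (fun γ hγ ↦ hkill ⟨γ.1, hle γ.2⟩ hγ)
  -- (1) an element with `q ∤ d` differs from an element of `Γ₀(Nq)` with the same `d` by a parabolic
  have key : ∀ γ : Gamma0 N, ¬ (q : ℤ) ∣ (γ : SL(2, ℤ)) 1 1 →
      ∃ γ' : Gamma0 (N * q), (γ' : SL(2, ℤ)) 1 1 = (γ : SL(2, ℤ)) 1 1 ∧ χ γ = χ' γ' := by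
    intro γ hqd
    set c := (γ : SL(2, ℤ)) 1 0 with hcdef
    set d := (γ : SL(2, ℤ)) 1 1 with hddef
    have hNc : (N : ℤ) ∣ c := by
      have hγ := γ.2
      rw [Gamma0_mem] at hγ
      exact (ZMod.intCast_zmod_eq_zero_iff_dvd _ N).mp hγ
    obtain ⟨c₀, hc₀⟩ := hNc
    -- Bézout: `u q + v d = 1`
    have hcop : IsCoprime (q : ℤ) d := by
      rw [Int.isCoprime_iff_gcd_eq_one, Int.gcd_comm, Int.gcd_eq_natAbs, Int.natAbs_natCast]
      refine Nat.Coprime.symm ((Nat.Prime.coprime_iff_not_dvd hq).mpr fun h ↦ hqd ?_)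
      exact Int.natCast_dvd.mpr h
    obtain ⟨u, v, huv⟩ := hcop
    set j : ℤ := v * c₀ with hj
    obtain ⟨L, hL00, hL01, hL10, hL11⟩ :=
      ThetaLayerLambdaCongruenceAtTwo.exists_gamma0_entries (N := N) 1 0 (-((N : ℤ) * j)) 1 (by ring)
        ⟨-j, by ring⟩
    have hL : χ L = 0 := hsmall L (by rw [hL00, hL11]; rfl)
    have hmem : ((γ * L : Gamma0 N) : SL(2, ℤ)) ∈ Gamma0 (N * q) := by
      rw [Gamma0_mem]
      have h10 : ((γ * L : Gamma0 N) : SL(2, ℤ)) 1 0 = c - d * (N * j) := by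
        rw [ThetaLayerLambdaCongruenceAtTwo.gamma0_mul_apply_one_zero, hL00, hL10]; ring
      change ((((γ * L : Gamma0 N) : SL(2, ℤ)) 1 0 : ℤ) : ZMod (N * q)) = 0
      rw [h10, ZMod.intCast_zmod_eq_zero_iff_dvd]
      refine ⟨c₀ * u, ?_⟩
      rw [hc₀, hj]
      push_cast
      linear_combination (-(N : ℤ) * c₀) * huv
    refine ⟨⟨((γ * L : Gamma0 N) : SL(2, ℤ)), hmem⟩, ?_, ?_⟩
    · change ((γ * L : Gamma0 N) : SL(2, ℤ)) 1 1 = d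
      rw [gamma0_mul_apply_one_one', hL01, hL11]; ring
    · change χ γ = χ ⟨((γ * L : Gamma0 N) : SL(2, ℤ)), _⟩
      have : (⟨((γ * L : Gamma0 N) : SL(2, ℤ)), (γ * L).2⟩ : Gamma0 N) = γ * L := rfl
      rw [this, hadd, hL, add_zero]
  -- (2) `ψM` kills the units `≡ 1 (mod N)`
  have hker : ∀ t : ℤ, ¬ (q : ℤ) ∣ 1 + t * N → ψM (((1 + t * N : ℤ)) : ZMod (N * q)) = 0 := by
    intro t ht
    obtain ⟨P, hP00, hP01, hP10, hP11⟩ :=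
      ThetaLayerLambdaCongruenceAtTwo.exists_gamma0_entries (N := N) (1 - t * N) (t ^ 2 * N) (-(N : ℤ)) (1 + t * N)
        (by ring) ⟨-1, by ring⟩
    have hP : χ P = 0 := hsmall P (by rw [hP00, hP11]; ring_nf; rfl)
    obtain ⟨P', hP'd, hχP⟩ := key P (by rw [hP11]; exact ht)
    rw [hP, hχψM P', hP'd, hP11] at hχP
    exact hχP.symm
  -- (2') hence `ψM` only depends on the residue mod `N` of a unit
  have hdep : ∀ x y : ZMod (N * q), IsUnit x → IsUnit y →
      ZMod.castHom (dvd_mul_right N q) (ZMod N) x = ZMod.castHom (dvd_mul_right N q) (ZMod N) y →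
      ψM x = ψM y := by
    intro x y hx hy hxy
    have hxinv : IsUnit x⁻¹ := by
      rw [← hx.unit_spec, ZMod.inv_coe_unit]; exact Units.isUnit _
    set r : ZMod (N * q) := y * x⁻¹ with hr
    have hr1 : IsUnit r := hy.mul hxinv
    have hyr : y = x * r := by rw [hr, mul_comm x, mul_assoc, ZMod.inv_mul_of_unit x hx, mul_one]
    have hcast : ZMod.castHom (dvd_mul_right N q) (ZMod N) r = 1 := by
      have h1 : ZMod.castHom (dvd_mul_right N q) (ZMod N) (x * x⁻¹) = 1 := by
        rw [ZMod.mul_inv_of_unit x hx, map_one]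
      rw [map_mul] at h1
      rw [hr, map_mul, ← hxy]
      exact h1
    -- `r = 1 + tN`
    have hrint : (((r.val : ℤ)) : ZMod (N * q)) = r := by
      rw [Int.cast_natCast, ZMod.natCast_zmod_val]
    have hrv : (((r.val : ℤ)) : ZMod N) = 1 := by
      have h := hcast
      rw [← hrint, ZMod.castHom_apply, ZMod.cast_intCast (dvd_mul_right N q)] at h
      exact h
    obtain ⟨t, ht⟩ : ∃ t : ℤ, (r.val : ℤ) = 1 + t * N := by
      obtain ⟨t, ht⟩ := (ZMod.intCast_eq_intCast_iff_dvd_sub 1 (r.val : ℤ) N).mp (by rw [hrv]; simp)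
      exact ⟨t, by linear_combination ht⟩
    have hqt : ¬ (q : ℤ) ∣ 1 + t * N := by
      rw [← ht]
      intro hdvd
      have hcop : IsCoprime (((N * q : ℕ)) : ℤ) (r.val : ℤ) := by
        rw [← ZMod.coe_int_isUnit_iff_isCoprime, hrint]; exact hr1
      have hu : IsUnit (q : ℤ) := hcop.isUnit_of_dvd' ⟨N, by push_cast; ring⟩ hdvd
      rcases Int.isUnit_iff.mp hu with h | h <;> omega
    have hψr : ψM r = 0 := by
      have := hker t hqt
      rwa [← ht, hrint] at this
    rw [hyr, hψM x r hx hr1, hψr, add_zero]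
  -- (3) every unit mod `N` lifts to a unit mod `Nq`
  have hlift : ∀ x : ZMod N, IsUnit x →
      ∃ X : ZMod (N * q), IsUnit X ∧ ZMod.castHom (dvd_mul_right N q) (ZMod N) X = x := by
    intro x hx
    obtain ⟨U, hU⟩ := ZMod.unitsMap_surjective (dvd_mul_right N q) hx.unit
    refine ⟨(U : ZMod (N * q)), U.isUnit, ?_⟩
    have := congrArg (fun w : (ZMod N)ˣ ↦ (w : ZMod N)) hU
    simpa [ZMod.unitsMap_def] using this
  choose! lift hliftU hliftC using hlift
  refine ⟨fun x ↦ if IsUnit x then ψM (lift x) else 0, ?_, ?_⟩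
  · intro x y hx hy
    have hxy : IsUnit (x * y) := hx.mul hy
    simp only [if_pos hx, if_pos hy, if_pos hxy]
    rw [← hψM _ _ (hliftU x hx) (hliftU y hy)]
    refine hdep _ _ (hliftU _ hxy) ((hliftU x hx).mul (hliftU y hy)) ?_
    rw [map_mul, hliftC _ hxy, hliftC x hx, hliftC y hy]
  · intro γ
    have hdu : IsUnit ((((γ : SL(2, ℤ)) 1 1 : ℤ) : ZMod N)) := isUnit_gamma0_apply_one_one γ
    simp only [if_pos hdu]
    -- an element `γ₁ ∈ {γ, γT}` with `q ∤ d(γ₁)`, `χ γ₁ = χ γ`, `d(γ₁) ≡ d(γ) (mod N)`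
    obtain ⟨γ₁, hq₁, hχ₁, hd₁⟩ : ∃ γ₁ : Gamma0 N, ¬ (q : ℤ) ∣ (γ₁ : SL(2, ℤ)) 1 1 ∧ χ γ₁ = χ γ ∧
        ((((γ₁ : SL(2, ℤ)) 1 1 : ℤ) : ZMod N)) = ((((γ : SL(2, ℤ)) 1 1 : ℤ) : ZMod N)) := by
      by_cases hqd : (q : ℤ) ∣ (γ : SL(2, ℤ)) 1 1
      · obtain ⟨T, hT00, hT01, hT10, hT11⟩ :=
          ThetaLayerLambdaCongruenceAtTwo.exists_gamma0_entries (N := N) 1 1 0 1 (by ring) ⟨0, by ring⟩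
        have hT : χ T = 0 := hsmall T (by rw [hT00, hT11]; rfl)
        have h11 : ((γ * T : Gamma0 N) : SL(2, ℤ)) 1 1 = (γ : SL(2, ℤ)) 1 0 + (γ : SL(2, ℤ)) 1 1 := by
          rw [gamma0_mul_apply_one_one', hT01, hT11]; ring
        have hc0 : ((((γ : SL(2, ℤ)) 1 0 : ℤ) : ZMod N)) = 0 := by
          have hγ := γ.2
          rw [Gamma0_mem] at hγ
          exact hγ
        refine ⟨γ * T, ?_, by rw [hadd, hT, add_zero], ?_⟩
        · rw [h11]
          intro h
          have hc : (q : ℤ) ∣ (γ : SL(2, ℤ)) 1 0 := by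
            have := dvd_sub h hqd
            rwa [add_sub_cancel_right] at this
          exact not_dvd_apply_one_zero_of_dvd_apply_one_one hq _ hqd hc
        · rw [h11, Int.cast_add, hc0, zero_add]
      · exact ⟨γ, hqd, rfl, rfl⟩
    obtain ⟨γ', hγ'd, hχγ'⟩ := key γ₁ hq₁
    rw [← hχ₁, hχγ', hχψM γ', hγ'd]
    refine hdep _ _ ?_ (hliftU _ hdu) ?_
    · rw [← hγ'd]; exact isUnit_gamma0_apply_one_one γ'
    · rw [hliftC _ hdu, ZMod.castHom_apply, ZMod.cast_intCast (dvd_mul_right N q), hd₁]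

end OnePrime

/-! ## §3. All divisors: (G″)_M ⟹ (G″)_N for `N ∣ M`; the named node and FLAT at every divisor -/

section Divisors

/-- **LEVEL LOWERING.** If the trace form (G″) holds at level `M ≠ 0` then it holds at every level `N ∣ M`: the set
of levels at which the curve-free spanning statement holds is closed under divisors (and a level where it fails poisons
all its multiples). One prime at a time (`cuspSpanTrace_of_mul_prime`, `nat_dvd_induction`).
[cite: ShimuraIATAF1971, Prop. 1.43] [cite: Knapp1993, Prop. 11.22] [cite: Pollack2003, Conj. 6.3] -/
theorem cuspSpanTrace_of_dvd {N M : ℕ} (hM : M ≠ 0) (hNM : N ∣ M)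
    (hG : ∀ χ : Gamma0 M → ZMod 2,
      (∀ γ δ : Gamma0 M, χ (γ * δ) = χ γ + χ δ) →
      (∀ γ : Gamma0 M, ((γ : SL(2, ℤ)) 0 0 + (γ : SL(2, ℤ)) 1 1).natAbs ≤ 2 → χ γ = 0) →
      (∀ γ : Gamma0 M, (∃ k : ℕ, 1 ≤ k ∧ ((γ : SL(2, ℤ)) 1 1).natAbs = 4 ^ k) → χ γ = 0) →
      ∃ ψ : ZMod M → ZMod 2, (∀ x y : ZMod M, IsUnit x → IsUnit y → ψ (x * y) = ψ x + ψ y) ∧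
        ∀ γ : Gamma0 M, χ γ = ψ ((((γ : SL(2, ℤ)) 1 1 : ℤ) : ZMod M))) :
    ∀ χ : Gamma0 N → ZMod 2,
      (∀ γ δ : Gamma0 N, χ (γ * δ) = χ γ + χ δ) →
      (∀ γ : Gamma0 N, ((γ : SL(2, ℤ)) 0 0 + (γ : SL(2, ℤ)) 1 1).natAbs ≤ 2 → χ γ = 0) →
      (∀ γ : Gamma0 N, (∃ k : ℕ, 1 ≤ k ∧ ((γ : SL(2, ℤ)) 1 1).natAbs = 4 ^ k) → χ γ = 0) →
      ∃ ψ : ZMod N → ZMod 2, (∀ x y : ZMod N, IsUnit x → IsUnit y → ψ (x * y) = ψ x + ψ y) ∧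
        ∀ γ : Gamma0 N, χ γ = ψ ((((γ : SL(2, ℤ)) 1 1 : ℤ) : ZMod N)) := by
  obtain ⟨k, rfl⟩ := hNM
  have hN : N ≠ 0 := fun h ↦ hM (by rw [h, zero_mul])
  have hk : k ≠ 0 := fun h ↦ hM (by rw [h, mul_zero])
  refine nat_dvd_induction
    (P := fun L ↦ ∀ χ : Gamma0 L → ZMod 2,
      (∀ γ δ : Gamma0 L, χ (γ * δ) = χ γ + χ δ) →
      (∀ γ : Gamma0 L, ((γ : SL(2, ℤ)) 0 0 + (γ : SL(2, ℤ)) 1 1).natAbs ≤ 2 → χ γ = 0) →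
      (∀ γ : Gamma0 L, (∃ k : ℕ, 1 ≤ k ∧ ((γ : SL(2, ℤ)) 1 1).natAbs = 4 ^ k) → χ γ = 0) →
      ∃ ψ : ZMod L → ZMod 2, (∀ x y : ZMod L, IsUnit x → IsUnit y → ψ (x * y) = ψ x + ψ y) ∧
        ∀ γ : Gamma0 L, χ γ = ψ ((((γ : SL(2, ℤ)) 1 1 : ℤ) : ZMod L)))
    (fun L q hL hq h ↦ ?_) k N hN hk hG
  haveI : NeZero L := ⟨hL⟩
  exact cuspSpanTrace_of_mul_prime hq h

/-- **The named node at every divisor.** The trace form (G″) at a level `M ≠ 0` gives `CuspSpanEvenAtTwo N` for every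
`N ∣ M` (`cuspSpanTrace_of_dvd` + `cuspSpanEvenAtTwo_of_cuspSpanTrace`). [cite: Pollack2003, Conj. 6.3] -/
theorem cuspSpanEvenAtTwo_of_cuspSpanTrace_of_dvd {N M : ℕ} [NeZero N] (hM : M ≠ 0) (hNM : N ∣ M)
    (hG : ∀ χ : Gamma0 M → ZMod 2,
      (∀ γ δ : Gamma0 M, χ (γ * δ) = χ γ + χ δ) →
      (∀ γ : Gamma0 M, ((γ : SL(2, ℤ)) 0 0 + (γ : SL(2, ℤ)) 1 1).natAbs ≤ 2 → χ γ = 0) →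
      (∀ γ : Gamma0 M, (∃ k : ℕ, 1 ≤ k ∧ ((γ : SL(2, ℤ)) 1 1).natAbs = 4 ^ k) → χ γ = 0) →
      ∃ ψ : ZMod M → ZMod 2, (∀ x y : ZMod M, IsUnit x → IsUnit y → ψ (x * y) = ψ x + ψ y) ∧
        ∀ γ : Gamma0 M, χ γ = ψ ((((γ : SL(2, ℤ)) 1 1 : ℤ) : ZMod M))) :
    CuspSpanEvenAtTwo N :=
  cuspSpanEvenAtTwo_of_cuspSpanTrace (cuspSpanTrace_of_dvd hM hNM hG)

end Divisors

end Summit.BirchSwinnertonDyer.BirchSwinnertonDyer.Theorems.SignedMuAtTwo
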